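import Literature.Analysis.FluidPDE.SereginEpsilonRegularityHigherHolds
import Literature.Analysis.FluidPDE.SereginSverakOffAxisAssembly
import HarnessLib

/-!
# Discharges of named facts of `SereginSverakOffAxisInputs.lean`

`Literature/Analysis/FluidPDE/SereginSverakOffAxisInputsHolds.lean` — proofs-only sibling of
`SereginSverakOffAxisInputs.lean` (no definitions, no named facts). Each theorem below closes
a named fact `X : Prop` of that file as `X_holds : X` by composing an ACCEPTED reduction
theorem of the tree with the ACCEPTED unconditional `_holds` discharges of all of its
hypotheses; nothing is re-proved and no statement is changed. Recorded by the librarian sweep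
g25 (2026-08-16, pass 5c: facts dischargeable in one line from the tree's own lemmas), so that
the facts census, `#h21_route_deps` and the cone guardrail see these facts as theorems.

Discharged here:

* `OffAxisSmoothRepresentative_holds` := `offAxisSmoothRepresentative_of_lemma61`
  `seregin2014_lemma61_holds` (`SereginSverakOffAxisAssembly.lean`).

## References

* [SereginSverak2009] — see `lean/references.bib` and the docstring of the fact in `SereginSverakOffAxisInputs.lean`.
-/

namespace Literature.Analysis.FluidPDE.SereginSverak2009

/-- **Discharge of the named fact `OffAxisSmoothRepresentative`**
(`SereginSverakOffAxisInputs.lean`): Off the axis, the pairs under the conditions of Theorem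
3.1 are "sufficiently smooth": the regularity inside the region of essential boundedness
(Seregin–Šverák 2009, arXiv:0804.1803, §2 p. … — obtained as
`offAxisSmoothRepresentative_of_lemma61` applied to the tree's unconditional discharge
`seregin2014_lemma61_holds` of its hypothesis (reduction in
`SereginSverakOffAxisAssembly.lean`).
[cite: SereginSverak2009, §2 p. 8 (regularity inside the region of essential boundedness) with §2 p. 6 / Remark 3.4] -/
theorem OffAxisSmoothRepresentative_holds :
    OffAxisSmoothRepresentative :=
  offAxisSmoothRepresentative_of_lemma61 Literature.Analysis.FluidPDE.seregin2014_lemma61_holds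

end Literature.Analysis.FluidPDE.SereginSverak2009
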